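import Summits.Schanuel.Schanuel.Theorems.ZilberEacParamCurveLogRayRootsPos
import Summits.Schanuel.Schanuel.Theorems.ZilberEacParamCurveRayRoots
import HarnessLib

/-!
# Polynomially parametrised base curves, XLIV: the root package with decay of a LOWER-ORDER
# escape polynomial on the small discs (towards ALL real-ratio curves)

HONEST FRAMING.  Cell `pub-schanuel` (Zilber's Exponential-Algebraic Closedness, case ladder;
host summit Schanuel), seat 2, gen 21.  Companion of file XXXIV (`exists_ray_roots_log_sub`,
gen 20): there the decay on the discs `‖z - z₀(j)‖ ≤ 2/(‖lc(R)‖ ‖z₀(j)‖^{d-1})` around the roots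
`z₀(j) = ρ_j ω + τ + o(1)` of `e^{R} = θ z^μ` came from the SUB-LEADING order of an escape
polynomial of the same degree as `R`; here the escape polynomial `G` is ANY polynomial of degree
`m ≥ 1` with `Re(lc(G) ω^m) < 0` on the root direction: uniformly on the discs
`Re G(z) ≤ -(|Re(lc(G) ω^m)|/2) ρ_j^m` (`abs_re_eval_sub_lead_le`: first-order estimate at
`ρω`; `exists_ray_roots_log_rem`: the package in the format of the engine of file XXXIII).  Used
over equal-degree curves with real leading ratio `λ`: `g₀ = R_s/(λ+s) - D/(λ+s)` with
`D = g₁ - λ g₀` of lower degree, so the decay of `e^{g₀}` along the balance roots of `R_s` is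
governed by `D`, with NO condition on the sub-leading coefficients (files XLV–XLVI).
Mantova–Masser's question is OPEN in general (PLMS 2024 §1 p. 5); NOT Schanuel's conjecture
(neither used nor implied; EAC ⇏ SC); `EC(3,2)` stays OPEN.
-/

noncomputable section

open Filter Topology Metric Set Complex Polynomial
open Literature.ModelTheory.Zilber
open Literature.Geometry.Symplectic.RotationBranch (norm_pow_sub_pow_le)

set_option linter.dupNamespace false

namespace Summit.Schanuel.Schanuel.Theorems

/-- **First-order estimate at `ρω`.**  `deg G = m + 1`, `b = lc(G)`; for `ρ ≥ 1` and `‖Y‖ ≤ Y₀`: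
`|Re G(ρω + Y) - Re(b ω^{m+1}) ρ^{m+1}| ≤ (‖b‖ (m+1) Y₀ + Σ|ℓ_i|) (‖ω‖ + Y₀ + 1)^m ρ^m`
(`ℓ = G - b X^{m+1}`). (new) -/
theorem abs_re_eval_sub_lead_le (G : Polynomial ℂ) {m : ℕ} (hm : G.natDegree = m + 1) (ω : ℂ)
    {Y₀ : ℝ} (hY₀ : 0 ≤ Y₀) {ρ : ℝ} (hρ : 1 ≤ ρ) {Y : ℂ} (hY : ‖Y‖ ≤ Y₀) :
    |(G.eval ((ρ : ℂ) * ω + Y)).re - (G.leadingCoeff * ω ^ (m + 1)).re * ρ ^ (m + 1)| ≤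
      (‖G.leadingCoeff‖ * ((m + 1 : ℕ) : ℝ) * Y₀ + coeffNormSum G.eraseLead) *
        (‖ω‖ + Y₀ + 1) ^ m * ρ ^ m := by
  obtain ⟨b, hb_def⟩ : ∃ b : ℂ, b = G.leadingCoeff := ⟨_, rfl⟩
  obtain ⟨ℓ, hℓ_def⟩ : ∃ ℓ : Polynomial ℂ, ℓ = G.eraseLead := ⟨_, rfl⟩
  rw [← hb_def, ← hℓ_def]
  have hℓdeg : ℓ.natDegree ≤ m := by
    rw [hℓ_def]; have := Polynomial.eraseLead_natDegree_le G; omega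
  have hρ0 : 0 ≤ ρ := zero_le_one.trans hρ
  set L : ℝ := ‖ω‖ + Y₀ + 1 with hL
  have hL1 : 1 ≤ L := by rw [hL]; linarith [norm_nonneg ω]
  set X : ℂ := (ρ : ℂ) * ω with hX_def
  set t : ℂ := X + Y with ht_def
  have hXnorm : ‖X‖ = ρ * ‖ω‖ := by
    rw [hX_def, norm_mul, Complex.norm_real, Real.norm_eq_abs, abs_of_nonneg hρ0]
  set M : ℝ := ρ * L with hM_def
  have hM1 : 1 ≤ M := one_le_mul_of_one_le_of_one_le hρ hL1
  have hXM : ‖X‖ ≤ M := by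
    rw [hXnorm, hM_def]
    exact mul_le_mul_of_nonneg_left (by rw [hL]; linarith) hρ0
  have htM : ‖t‖ ≤ M := by
    calc ‖t‖ ≤ ‖X‖ + ‖Y‖ := norm_add_le _ _
      _ ≤ ρ * ‖ω‖ + Y₀ := by rw [hXnorm]; linarith
      _ ≤ ρ * ‖ω‖ + ρ * Y₀ + ρ * 1 := by
          have hY1 : Y₀ ≤ ρ * Y₀ := le_mul_of_one_le_left hY₀ hρ
          linarith
      _ = M := by rw [hM_def, hL]; ring
  have hdec : G.eval t = b * X ^ (m + 1) + (b * (t ^ (m + 1) - X ^ (m + 1)) + ℓ.eval t) := by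
    rw [eval_eq_eraseLead_add G, ← hℓ_def, ← hb_def, hm]; ring
  have hR₂ := norm_pow_sub_pow_le htM hXM (m + 1)
  simp only [Nat.add_sub_cancel] at hR₂
  rw [show t - X = Y by rw [ht_def]; ring] at hR₂
  have hℓn : ‖ℓ.eval t‖ ≤ coeffNormSum ℓ * M ^ m := norm_eval_le_of_natDegree_le ℓ hM1 htM hℓdeg
  have hjunk : ‖b * (t ^ (m + 1) - X ^ (m + 1)) + ℓ.eval t‖ ≤
      (‖b‖ * ((m + 1 : ℕ) : ℝ) * Y₀ + coeffNormSum ℓ) * L ^ m * ρ ^ m := by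
    have hMm : M ^ m = ρ ^ m * L ^ m := by rw [hM_def, mul_pow]
    have h1' : ‖b * (t ^ (m + 1) - X ^ (m + 1))‖ ≤ ‖b‖ * (((m + 1 : ℕ) : ℝ) * M ^ m * Y₀) := by
      rw [norm_mul]
      refine mul_le_mul_of_nonneg_left (hR₂.trans ?_) (norm_nonneg b)
      push_cast
      exact mul_le_mul_of_nonneg_left hY (by positivity)
    calc ‖b * (t ^ (m + 1) - X ^ (m + 1)) + ℓ.eval t‖
        ≤ ‖b * (t ^ (m + 1) - X ^ (m + 1))‖ + ‖ℓ.eval t‖ := norm_add_le _ _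
      _ ≤ ‖b‖ * (((m + 1 : ℕ) : ℝ) * M ^ m * Y₀) + coeffNormSum ℓ * M ^ m := add_le_add h1' hℓn
      _ = (‖b‖ * ((m + 1 : ℕ) : ℝ) * Y₀ + coeffNormSum ℓ) * L ^ m * ρ ^ m := by
          rw [hMm]; push_cast; ring
  have hXpow : X ^ (m + 1) = ((ρ ^ (m + 1) : ℝ) : ℂ) * ω ^ (m + 1) := by
    rw [hX_def, mul_pow]; push_cast; ring
  have hre1 : (b * X ^ (m + 1)).re = (b * ω ^ (m + 1)).re * ρ ^ (m + 1) := by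
    rw [hXpow, show b * (((ρ ^ (m + 1) : ℝ) : ℂ) * ω ^ (m + 1)) =
      (b * ω ^ (m + 1)) * ((ρ ^ (m + 1) : ℝ) : ℂ) by ring, Complex.re_mul_ofReal]
  rw [hdec, Complex.add_re, hre1, add_sub_cancel_left]
  exact (Complex.abs_re_le_norm _).trans hjunk

/-- **The root package with decay of a lower-order escape polynomial on the small discs.**  See
the module docstring. (new) -/
theorem exists_ray_roots_log_rem (R G : Polynomial ℂ) (hd : 2 ≤ R.natDegree)
    (hm : 1 ≤ G.natDegree) (ω : ℂ) (s : ℤ) (hs : s = 1 ∨ s = -1)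
    (hω : R.leadingCoeff * ω ^ R.natDegree = 2 * Real.pi * I * s)
    (hdir : (G.leadingCoeff * ω ^ G.natDegree).re < 0) (μ : ℝ) (c₀ : ℂ) :
    ∃ (z₀ Lg : ℕ → ℂ) (Λ Λ' : ℕ → ℝ) (K₀ : ℕ), Tendsto Λ atTop atTop ∧ (∀ j, 0 ≤ Λ' j) ∧
      (∀ (N : ℕ) (c : ℝ), 0 < c →
        Tendsto (fun j => (2 + 3 * Λ j) ^ N * Real.exp (-(c * Λ' j))) atTop (𝓝 0)) ∧
      Tendsto (fun j => z₀ j - (((j + K₀ : ℕ) : ℂ) + 1) * ω) atTop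
        (𝓝 (-(R.coeff (R.natDegree - 1) / (R.natDegree * R.leadingCoeff)))) ∧
      ∀ j, exp (Lg j) = z₀ j ∧ exp (R.eval (z₀ j)) = exp c₀ * exp ((μ : ℂ) * Lg j) ∧
        1 ≤ ‖z₀ j‖ ∧ 2 ≤ ‖R.leadingCoeff‖ * ‖z₀ j‖ ∧ Λ j / 3 ≤ ‖z₀ j‖ ∧ ‖z₀ j‖ ≤ 3 * Λ j ∧
        16 ≤ ‖z₀ j‖ ∧
        ∀ z : ℂ, ‖z - z₀ j‖ ≤ 2 / (‖R.leadingCoeff‖ * ‖z₀ j‖ ^ (R.natDegree - 1)) →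
          (G.eval z).re ≤ -Λ' j := by
  obtain ⟨m, hmG⟩ : ∃ m : ℕ, G.natDegree = m + 1 := ⟨G.natDegree - 1, by omega⟩
  rw [hmG] at hdir
  set τ : ℂ := -(R.coeff (R.natDegree - 1) / (R.natDegree * R.leadingCoeff)) with hτ_def
  set κ : ℝ := (G.leadingCoeff * ω ^ (m + 1)).re with hκ_def
  have hκ : κ < 0 := hdir
  have hκpos : 0 < |κ| := abs_pos.2 hκ.ne
  set a : ℂ := R.leadingCoeff with ha_def
  set d : ℕ := R.natDegree with hd_def
  have hd1 : 1 ≤ d - 1 := by omega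
  have hR0 : R ≠ 0 := by
    rintro rfl; rw [hd_def, Polynomial.natDegree_zero] at hd; omega
  have ha0 : a ≠ 0 := Polynomial.leadingCoeff_ne_zero.2 hR0
  have hapos : 0 < ‖a‖ := norm_pos_iff.2 ha0
  have hrhs : (2 * Real.pi * I * s : ℂ) ≠ 0 := by
    have hsC : (s : ℂ) ≠ 0 := by rcases hs with rfl | rfl <;> simp
    have hπ : (Real.pi : ℂ) ≠ 0 := Complex.ofReal_ne_zero.mpr Real.pi_pos.ne'
    simp [hsC, hπ, Complex.I_ne_zero]
  have hω0 : ω ≠ 0 := by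
    rintro rfl; rw [zero_pow (by omega), mul_zero] at hω; exact hrhs hω.symm
  have hωpos : 0 < ‖ω‖ := norm_pos_iff.mpr hω0
  -- the roots with their position
  obtain ⟨z₀, Lg, K₀, hz₀norm, hz₀pos, hroot⟩ := exists_ray_roots_log_pos R hd ω s hs hω μ c₀
  rw [← hτ_def] at hz₀pos
  set ρ : ℕ → ℝ := fun j => ((j + K₀ : ℕ) : ℝ) + 1 with hρ_def
  have hρC : ∀ j, (((j + K₀ : ℕ) : ℂ) + 1) = ((ρ j : ℝ) : ℂ) := fun j => by
    rw [hρ_def]; push_cast; ring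
  have hρ : Tendsto ρ atTop atTop :=
    (tendsto_natCast_add_atTop 1).comp (tendsto_add_atTop_nat K₀)
  have hρ1 : ∀ j, 1 ≤ ρ j := fun j => by
    have : (0 : ℝ) ≤ ((j + K₀ : ℕ) : ℝ) := Nat.cast_nonneg _
    simp only [hρ_def]; linarith
  -- constants of the pointwise estimate (`Y₀ = ‖τ‖ + 2`)
  set Y₀ : ℝ := ‖τ‖ + 2 with hY₀
  have hY₀0 : 0 ≤ Y₀ := by positivity
  set Kj : ℝ := (‖G.leadingCoeff‖ * ((m + 1 : ℕ) : ℝ) * Y₀ + coeffNormSum G.eraseLead) *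
    (‖ω‖ + Y₀ + 1) ^ m with hKj
  have hKj0 : 0 ≤ Kj := by have := coeffNormSum_nonneg G.eraseLead; positivity
  -- eventual conditions
  have hev1 : ∀ᶠ j in atTop, ‖z₀ j - ((ρ j : ℂ) * ω + τ)‖ ≤ 1 := by
    have h := hz₀pos (Metric.closedBall_mem_nhds τ one_pos)
    filter_upwards [h] with j hj
    rw [Set.mem_preimage, Metric.mem_closedBall, dist_eq_norm, hρC] at hj
    rw [show z₀ j - ((ρ j : ℂ) * ω + τ) = z₀ j - (ρ j : ℂ) * ω - τ by ring]
    exact hj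
  have hev2 : ∀ᶠ j in atTop, 2 / (‖a‖ * ‖z₀ j‖ ^ (d - 1)) ≤ 1 := by
    have hb : Tendsto (fun j => 2 / (‖a‖ * ‖z₀ j‖)) atTop (𝓝 0) :=
      tendsto_const_nhds.div_atTop (hz₀norm.const_mul_atTop hapos)
    filter_upwards [hb (Iic_mem_nhds one_pos)] with j hj
    rw [Set.mem_preimage, Set.mem_Iic] at hj
    refine le_trans ?_ hj
    have hz1 : 1 ≤ ‖z₀ j‖ := (hroot j).2.2.1
    refine div_le_div_of_nonneg_left (by norm_num) (by positivity) ?_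
    refine mul_le_mul_of_nonneg_left ?_ hapos.le
    calc ‖z₀ j‖ = ‖z₀ j‖ ^ 1 := (pow_one _).symm
      _ ≤ ‖z₀ j‖ ^ (d - 1) := pow_le_pow_right₀ hz1 hd1
  have hev3 : ∀ᶠ j in atTop, 2 * Kj / |κ| ≤ ρ j := hρ.eventually_ge_atTop _
  have hev4 : ∀ᶠ j in atTop, 16 ≤ ‖z₀ j‖ := hz₀norm.eventually_ge_atTop 16
  have hev5 : ∀ᶠ j in atTop, 3 * (‖τ‖ + 1) ≤ ρ j * ‖ω‖ :=
    (hρ.atTop_mul_const hωpos).eventually_ge_atTop _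
  obtain ⟨K₂, hK₂⟩ := eventually_atTop.1 (hev1.and (hev2.and (hev3.and (hev4.and hev5))))
  -- the reindexed package
  refine ⟨fun j => z₀ (j + K₂), fun j => Lg (j + K₂), fun j => ρ (j + K₂) * ‖ω‖,
    fun j => |κ| / 2 * ρ (j + K₂) ^ (m + 1), K₂ + K₀, ?_, fun j => by positivity, ?_, ?_,
    fun j => ?_⟩
  · exact (hρ.comp (tendsto_add_atTop_nat K₂)).atTop_mul_const hωpos
  · intro N c' hc'0
    have hc'' : 0 < c' * |κ| / 2 := by positivity
    have hkk := hρ.comp (tendsto_add_atTop_nat K₂)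
    have h0 := (tendsto_pow_mul_exp_neg_mul hc'' N).comp hkk
    have h1 : Tendsto (fun j : ℕ => (2 + 3 * ‖ω‖) ^ N *
        (ρ (j + K₂) ^ N * Real.exp (-(c' * |κ| / 2 * ρ (j + K₂))))) atTop
        (𝓝 ((2 + 3 * ‖ω‖) ^ N * 0)) := h0.const_mul _
    rw [mul_zero] at h1
    refine squeeze_zero (fun j => by positivity) (fun j => ?_) h1
    have hk1 := hρ1 (j + K₂)
    have hbase : 2 + 3 * (ρ (j + K₂) * ‖ω‖) ≤ (2 + 3 * ‖ω‖) * ρ (j + K₂) := by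
      nlinarith [norm_nonneg ω]
    have hexp : Real.exp (-(c' * (|κ| / 2 * ρ (j + K₂) ^ (m + 1)))) ≤
        Real.exp (-(c' * |κ| / 2 * ρ (j + K₂))) := by
      refine Real.exp_le_exp.2 (neg_le_neg ?_)
      have hp : ρ (j + K₂) ≤ ρ (j + K₂) ^ (m + 1) := by
        calc ρ (j + K₂) = ρ (j + K₂) ^ 1 := (pow_one _).symm
          _ ≤ ρ (j + K₂) ^ (m + 1) := pow_le_pow_right₀ hk1 (by omega)
      have : c' * |κ| / 2 * ρ (j + K₂) ≤ c' * |κ| / 2 * ρ (j + K₂) ^ (m + 1) :=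
        mul_le_mul_of_nonneg_left hp hc''.le
      linarith
    calc (2 + 3 * (ρ (j + K₂) * ‖ω‖)) ^ N * Real.exp (-(c' * (|κ| / 2 * ρ (j + K₂) ^ (m + 1))))
        ≤ ((2 + 3 * ‖ω‖) * ρ (j + K₂)) ^ N * Real.exp (-(c' * |κ| / 2 * ρ (j + K₂))) :=
          mul_le_mul (pow_le_pow_left₀ (by positivity) hbase N) hexp (Real.exp_nonneg _)
            (by positivity)
      _ = (2 + 3 * ‖ω‖) ^ N * (ρ (j + K₂) ^ N * Real.exp (-(c' * |κ| / 2 * ρ (j + K₂)))) := by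
          rw [mul_pow]; ring
  · have h := hz₀pos.comp (tendsto_add_atTop_nat K₂)
    refine h.congr fun j => ?_
    simp only [Function.comp_apply]
    rw [show j + K₂ + K₀ = j + (K₂ + K₀) by omega]
  · obtain ⟨h1, h2, h3, h4, h5⟩ := hK₂ (j + K₂) (Nat.le_add_left _ _)
    obtain ⟨hLz, hz₀e, hz₀1, hz₀2⟩ := hroot (j + K₂)
    have hρj := hρ1 (j + K₂)
    have hρ0 : 0 ≤ ρ (j + K₂) := zero_le_one.trans hρj
    have hdev : ‖z₀ (j + K₂) - (ρ (j + K₂) : ℂ) * ω‖ ≤ ‖τ‖ + 1 := by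
      have e : z₀ (j + K₂) - (ρ (j + K₂) : ℂ) * ω =
          (z₀ (j + K₂) - ((ρ (j + K₂) : ℂ) * ω + τ)) + τ := by ring
      rw [e]
      refine (norm_add_le _ _).trans ?_
      linarith
    have hXnorm : ‖(ρ (j + K₂) : ℂ) * ω‖ = ρ (j + K₂) * ‖ω‖ := by
      rw [norm_mul, Complex.norm_real, Real.norm_eq_abs, abs_of_nonneg hρ0]
    refine ⟨hLz, hz₀e, hz₀1, hz₀2, ?_, ?_, h4, fun z hz => ?_⟩
    · have := norm_sub_norm_le ((ρ (j + K₂) : ℂ) * ω) (z₀ (j + K₂))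
      rw [norm_sub_rev, hXnorm] at this
      linarith
    · have := norm_le_insert' (z₀ (j + K₂)) ((ρ (j + K₂) : ℂ) * ω)
      rw [hXnorm] at this
      linarith
    · -- the first-order decay on the small disc
      set Y : ℂ := z - (ρ (j + K₂) : ℂ) * ω with hY_def
      have hzY : z = (ρ (j + K₂) : ℂ) * ω + Y := by rw [hY_def]; ring
      have hYb : ‖Y‖ ≤ Y₀ := by
        have e : Y = (z - z₀ (j + K₂)) + (z₀ (j + K₂) - (ρ (j + K₂) : ℂ) * ω) := by
          rw [hY_def]; ring
        rw [e]
        refine (norm_add_le _ _).trans ?_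
        rw [hY₀]; linarith [hz.trans h2]
      have hpt := abs_re_eval_sub_lead_le G hmG ω hY₀0 hρj hYb
      rw [← hzY, ← hκ_def, ← hKj] at hpt
      have hKρ : Kj * ρ (j + K₂) ^ m ≤ |κ| / 2 * ρ (j + K₂) ^ (m + 1) := by
        have h3' : Kj ≤ |κ| / 2 * ρ (j + K₂) := by
          rw [div_le_iff₀ hκpos] at h3; linarith
        calc Kj * ρ (j + K₂) ^ m ≤ (|κ| / 2 * ρ (j + K₂)) * ρ (j + K₂) ^ m :=
            mul_le_mul_of_nonneg_right h3' (by positivity)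
          _ = |κ| / 2 * ρ (j + K₂) ^ (m + 1) := by ring
      have habs := (abs_le.1 (hpt.trans hKρ)).2
      have hκabs : |κ| = -κ := abs_of_neg hκ
      rw [hκabs] at habs ⊢
      nlinarith [pow_nonneg hρ0 (m + 1)]

end Summit.Schanuel.Schanuel.Theorems
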